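import Mathlib
import HarnessLib
import Summits.NavierStokesRegularity.NavierStokesRegularity.Theorems.QuarterLogPincerHelmholtzCentreDefs
import Literature.Analysis.FluidPDE.LocalBiotSavartHelmholtz
import Literature.Analysis.FluidPDE.BiotSavartBounds
import Literature.Analysis.FluidPDE.TaoEnstrophyLocalisation

/-!
# Route `QuarterLogPincer`, crux `TypeIQuantSubcubicExp` (stmt-NavierStokesRegularity-24077), line `vortical_centre` —
# H2♭ `stub_shellKernelBound : ShellKernelBound` BY NAME (hence Sb `SilencingCost.VorticalCentre` via `…HelmholtzCentreKernel`)

VERBATIM port (body byte-identical) of ★ `shellKernelBound_holds : ShellKernelBound` (§1♭) from ns-idea-7's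
`Cruxes/TypeIQuantSubcubicExp/Lines/vortical_centre.lean` v1.4 (crux-write 66fe6c6c1ffc; idea-crit-4 re-stamp PASS carries 10:55:05Z,
kernel rc 0 · sorries 0 · warnings 0, standard axioms), against the ACCEPTED `…HelmholtzCentreDefs` (`cutVorticity`, `ShellKernelBound` BY NAME).
Content (linear vector calculus for `C²` divergence-free fields; no Navier–Stokes): (a) the scale-covariant brick
`‖D²(ballCutoff c r)(z)‖ ≤ C₂/r²` (`exists_norm_iteratedFDeriv_two_ballCutoff_le`: `ballCutoff_eq_scale` +
`ContinuousLinearMap.iteratedFDeriv_comp_right`); (b) vanishing of `Dχ`, `D²χ` on the plateau `B(c,2r)` and off `B̄(c,3r)`, and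
`|Δχ| ≤ 3‖D²χ‖`; (c) the centre identity `v(y) − K∗(χω)(y) = ∫Γ(y−z)G(z)dz` (tree `smul_eq_biotSavart_add_integral_newtonKernel`), the density
split `G = curlCLM(Dχ ⊗ ω) + 2Σᵢ∂ᵢχ∂ᵢv + (Δχ)v` (tree `laplacian_smul_add_curl_smul_curl_eq`), ONE integration by parts per frame index
(tree `integral_newtonKernel_smul_fderiv_eq`, `Φᵢ = ∂ᵢχ·v ∈ C¹_c`), the shell bounds `|Γ(y−z)| ≤ R⁻¹`, `‖DΓ(y−z)‖ ≤ R⁻²` for `‖y−z‖ ≥ 2R/3`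
(`abs_newtonKernel`, `norm_fderiv_newtonKernel_le`, `π > 3`), `‖Dχ‖ ≤ 3C₀/R` (tree `exists_norm_fderiv_ballCutoff_le`), `‖D²χ‖ ≤ 9C₂/R²`, and
the majorants `1_{B̄(y,R)}‖v‖`, `1_{B̄(y,R)}‖curl v‖`; constant `C = 1 + 81C₂ + 18C₀ + 3‖curlCLM‖C₀`.  With `…HelmholtzCentreKernel`
(`vorticalCentre_of_shellKernelBound`) this makes Sb `SilencingCost.VorticalCentre` a tree theorem (`vorticalCentre_holds` below is NOT stated here to
keep this file independent of the Kernel module; the one-liner is `vorticalCentre_of_shellKernelBound shellKernelBound_holds`).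
HONEST FRAME: closes the last registered stub of the line `vortical_centre`; nothing here bears on 24077's truth, W7 or Navier–Stokes regularity
(OPEN / not proved).  Body by ns-idea-7 (g13); sources Gilbarg–Trudinger §2.4 (2.16)–(2.17), Majda–Bertozzi Prop. 2.16, Grujić 2009 §3.
-/

set_option linter.dupNamespace false

noncomputable section

open MeasureTheory Set Function Filter Topology Metric InnerProductSpace
open scoped ENNReal NNReal Laplacian
open Literature.Analysis Literature.Analysis.FluidPDE

namespace Summit.NavierStokesRegularity.NavierStokesRegularity.Cruxes.TypeIQuantSubcubicExp.HelmholtzCentre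

/-! ### Cutoff calculus, the centre identity, the shell bound -/

/-! #### (a) scale-covariant second-derivative bound for `ballCutoff` (NEW brick) -/

theorem exists_norm_iteratedFDeriv_two_ballCutoff_le :
    ∃ C₂ : ℝ, 0 ≤ C₂ ∧ ∀ (c : (EuclideanSpace ℝ (Fin 3))) (r : ℝ), 0 < r → ∀ z : (EuclideanSpace ℝ (Fin 3)),
      ‖iteratedFDeriv ℝ 2 (ballCutoff c r) z‖ ≤ C₂ / r ^ 2 := by
  set θ : (EuclideanSpace ℝ (Fin 3)) → ℝ := radialCutoff 2 3 with hθ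
  have hθs : ContDiff ℝ 2 θ := radialCutoff_contDiff 2 3
  have hθc : HasCompactSupport θ := hasCompactSupport_radialCutoff (by norm_num) (by norm_num)
  obtain ⟨C, hC⟩ := (hθs.continuous_iteratedFDeriv (m := 2) le_rfl).bounded_above_of_compact_support
    (hθc.iteratedFDeriv (𝕜 := ℝ) 2)
  refine ⟨max C 0, le_max_right _ _, fun c r hr z => ?_⟩
  set L : (EuclideanSpace ℝ (Fin 3)) →L[ℝ] (EuclideanSpace ℝ (Fin 3)) := r⁻¹ • ContinuousLinearMap.id ℝ (EuclideanSpace ℝ (Fin 3)) with hL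
  have hfun : ballCutoff c r = fun y => (θ ∘ ⇑L) (y - c) := by
    funext y
    rw [ballCutoff_eq_scale hr y]
    simp [hL, hθ]
  have hnL : ‖L‖ ≤ r⁻¹ := by
    rw [hL, norm_smul, norm_inv, Real.norm_of_nonneg hr.le]
    exact mul_le_of_le_one_right (inv_nonneg.2 hr.le) ContinuousLinearMap.norm_id_le
  rw [hfun, show (fun y => (θ ∘ ⇑L) (y - c)) = fun y => (θ ∘ ⇑L) (y - c) from rfl,
    congrFun (iteratedFDeriv_comp_sub' (𝕜 := ℝ) (f := θ ∘ ⇑L) 2 c) z,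
    ContinuousLinearMap.iteratedFDeriv_comp_right L hθs (z - c) (i := 2) le_rfl]
  calc ‖(iteratedFDeriv ℝ 2 θ (L (z - c))).compContinuousLinearMap fun _ => L‖
      ≤ ‖iteratedFDeriv ℝ 2 θ (L (z - c))‖ * ∏ _i : Fin 2, ‖L‖ :=
        ContinuousMultilinearMap.norm_compContinuousLinearMap_le _ _
    _ ≤ max C 0 * (r⁻¹) ^ 2 := by
        rw [Finset.prod_const, Finset.card_univ, Fintype.card_fin]
        exact mul_le_mul ((hC _).trans (le_max_left _ _)) (pow_le_pow_left₀ (norm_nonneg _) hnL 2)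
          (by positivity) (le_max_right _ _)
    _ = max C 0 / r ^ 2 := by rw [div_eq_mul_inv, inv_pow]

/-! #### (b) the cutoff's derivatives vanish on the plateau `B(c,2r)` and off `B̄(c,3r)`; `|Δχ| ≤ 3‖D²χ‖` -/

theorem fderiv_ballCutoff_eq_zero_of_mem {c : (EuclideanSpace ℝ (Fin 3))} {r : ℝ} (hr : 0 < r) {z : (EuclideanSpace ℝ (Fin 3))} (hz : z ∈ ball c (2 * r)) :
    fderiv ℝ (ballCutoff c r) z = 0 := by
  rw [(ballCutoff_eventuallyEq_one hr hz).fderiv_eq, fderiv_const_apply]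

theorem fderiv_ballCutoff_eq_zero_of_notMem {c : (EuclideanSpace ℝ (Fin 3))} {r : ℝ} (hr : 0 < r) {z : (EuclideanSpace ℝ (Fin 3))}
    (hz : z ∉ closedBall c (3 * r)) : fderiv ℝ (ballCutoff c r) z = 0 := by
  rw [(ballCutoff_eventuallyEq_zero hr hz).fderiv_eq, fderiv_const_apply]

theorem iteratedFDeriv_two_ballCutoff_eq_zero_of_mem {c : (EuclideanSpace ℝ (Fin 3))} {r : ℝ} (hr : 0 < r) {z : (EuclideanSpace ℝ (Fin 3))}
    (hz : z ∈ ball c (2 * r)) : iteratedFDeriv ℝ 2 (ballCutoff c r) z = 0 := by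
  rw [((ballCutoff_eventuallyEq_one hr hz).iteratedFDeriv (𝕜 := ℝ) 2).eq_of_nhds, iteratedFDeriv_const_of_ne (by norm_num)]
  rfl

theorem iteratedFDeriv_two_ballCutoff_eq_zero_of_notMem {c : (EuclideanSpace ℝ (Fin 3))} {r : ℝ} (hr : 0 < r) {z : (EuclideanSpace ℝ (Fin 3))}
    (hz : z ∉ closedBall c (3 * r)) : iteratedFDeriv ℝ 2 (ballCutoff c r) z = 0 := by
  rw [((ballCutoff_eventuallyEq_zero hr hz).iteratedFDeriv (𝕜 := ℝ) 2).eq_of_nhds, iteratedFDeriv_const_of_ne (by norm_num)]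
  rfl

/-- `|D²χ(z)(a,b)| ≤ ‖D²χ(z)‖‖a‖‖b‖` specialised to unit vectors of an orthonormal basis. -/
theorem abs_iteratedFDeriv_two_apply_le (χ : (EuclideanSpace ℝ (Fin 3)) → ℝ) (z a b : (EuclideanSpace ℝ (Fin 3))) (ha : ‖a‖ = 1) (hb : ‖b‖ = 1) :
    |iteratedFDeriv ℝ 2 χ z ![a, b]| ≤ ‖iteratedFDeriv ℝ 2 χ z‖ := by
  rw [← Real.norm_eq_abs]
  refine (ContinuousMultilinearMap.le_opNorm _ _).trans ?_
  rw [Fin.prod_univ_two]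
  simp [ha, hb]

/-- `|Δχ(z)| ≤ 3‖D²χ(z)‖`. -/
theorem abs_laplacian_le_three_mul_norm_iteratedFDeriv (χ : (EuclideanSpace ℝ (Fin 3)) → ℝ) (z : (EuclideanSpace ℝ (Fin 3))) :
    |(Δ χ) z| ≤ 3 * ‖iteratedFDeriv ℝ 2 χ z‖ := by
  set b := stdOrthonormalBasis ℝ (EuclideanSpace ℝ (Fin 3)) with hb
  rw [laplacian_eq_iteratedFDeriv_orthonormalBasis χ b]
  have h1 : ∀ i, |iteratedFDeriv ℝ 2 χ z ![b i, b i]| ≤ ‖iteratedFDeriv ℝ 2 χ z‖ := fun i =>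
    abs_iteratedFDeriv_two_apply_le χ z (b i) (b i) (b.orthonormal.1 i) (b.orthonormal.1 i)
  have hcard : (Finset.univ : Finset (Fin (Module.finrank ℝ (EuclideanSpace ℝ (Fin 3))))).card = 3 := by
    rw [Finset.card_univ, Fintype.card_fin, finrank_euclideanSpace, Fintype.card_fin]
  calc |∑ i, iteratedFDeriv ℝ 2 χ z ![b i, b i]|
      ≤ ∑ i, |iteratedFDeriv ℝ 2 χ z ![b i, b i]| := Finset.abs_sum_le_sum_abs _ _
    _ ≤ ∑ _i : Fin (Module.finrank ℝ (EuclideanSpace ℝ (Fin 3))), ‖iteratedFDeriv ℝ 2 χ z‖ := Finset.sum_le_sum fun i _ => h1 i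
    _ = 3 * ‖iteratedFDeriv ℝ 2 χ z‖ := by rw [Finset.sum_const, hcard]; simp


/-! #### (c) the centre identity, integration by parts, and the shell bound -/

set_option maxHeartbeats 4000000 in
/-- **H2♭ `ShellKernelBound` HOLDS (v1.4).**  Green representation at the centre + density split + one
integration by parts per frame index (tree `integral_newtonKernel_smul_fderiv_eq`) + the shell bounds
`|Γ| ≤ R⁻¹`, `‖DΓ‖ ≤ R⁻²`, `‖Dχ‖ ≤ 3C₀/R`, `‖D²χ‖ ≤ 9C₂/R²`; constant `C = 1 + 81C₂ + 18C₀ + 3‖curlCLM‖C₀`. -/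
theorem shellKernelBound_holds : ShellKernelBound := by
  obtain ⟨C₀, hC₀0, hC₀⟩ := exists_norm_fderiv_ballCutoff_le
  obtain ⟨C₂, hC₂0, hC₂⟩ := exists_norm_iteratedFDeriv_two_ballCutoff_le
  have hκ0 : 0 ≤ ‖curlCLM‖ := by positivity
  refine ⟨1 + 81 * C₂ + 18 * C₀ + 3 * ‖curlCLM‖ * C₀,
    by nlinarith [mul_nonneg hκ0 hC₀0], ?_⟩
  intro v hv hdiv y R hR
  have hR0 : R ≠ 0 := hR.ne'
  have hr : 0 < R / 3 := by positivity
  -- the cutoff `χ = ballCutoff y (R/3)` under an opaque name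
  obtain ⟨χ, hχdef⟩ : ∃ χ : (EuclideanSpace ℝ (Fin 3)) → ℝ, χ = ballCutoff y (R / 3) := ⟨_, rfl⟩
  have hχ2 : ContDiff ℝ 2 χ := by rw [hχdef]; exact contDiff_ballCutoff y (R / 3)
  have hχ1 : ContDiff ℝ 1 χ := by rw [hχdef]; exact contDiff_ballCutoff y (R / 3)
  have hχc : HasCompactSupport χ := by rw [hχdef]; exact hasCompactSupport_ballCutoff hr
  have hχy : χ y = 1 := by
    rw [hχdef]; exact ballCutoff_eq_one hr (by rw [sub_self, norm_zero]; positivity)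
  have hDχ : ∀ z, ‖fderiv ℝ χ z‖ ≤ 3 * C₀ * R⁻¹ := by
    intro z
    have h := hC₀ y (R / 3) hr z
    rw [← hχdef] at h
    calc ‖fderiv ℝ χ z‖ ≤ C₀ / (R / 3) := h
      _ = 3 * C₀ * R⁻¹ := by rw [div_div_eq_mul_div, div_eq_mul_inv]; ring
  have hD2χ : ∀ z, ‖iteratedFDeriv ℝ 2 χ z‖ ≤ 9 * C₂ * (R ^ 2)⁻¹ := by
    intro z
    have h := hC₂ y (R / 3) hr z
    rw [← hχdef] at h
    calc ‖iteratedFDeriv ℝ 2 χ z‖ ≤ C₂ / (R / 3) ^ 2 := h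
      _ = 9 * C₂ * (R ^ 2)⁻¹ := by rw [div_pow, div_div_eq_mul_div, div_eq_mul_inv]; ring
  -- off the shell `B̄(y,R) \ B(y,2R/3)` the cutoff is locally constant
  have hoff : ∀ z, z ∉ closedBall y R \ ball y (2 * (R / 3)) →
      fderiv ℝ χ z = 0 ∧ iteratedFDeriv ℝ 2 χ z = 0 := by
    intro z hz
    rw [Set.mem_sdiff, not_and, not_not] at hz
    by_cases h1 : z ∈ closedBall y R
    · have h2 := hz h1
      rw [hχdef]
      exact ⟨fderiv_ballCutoff_eq_zero_of_mem hr h2, iteratedFDeriv_two_ballCutoff_eq_zero_of_mem hr h2⟩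
    · have h1' : z ∉ closedBall y (3 * (R / 3)) := by rwa [show 3 * (R / 3) = R by ring]
      rw [hχdef]
      exact ⟨fderiv_ballCutoff_eq_zero_of_notMem hr h1',
        iteratedFDeriv_two_ballCutoff_eq_zero_of_notMem hr h1'⟩
  have hcase : ∀ z, (z ∈ closedBall y R ∧ 2 * (R / 3) ≤ ‖y - z‖) ∨
      (fderiv ℝ χ z = 0 ∧ iteratedFDeriv ℝ 2 χ z = 0) := by
    intro z
    by_cases hz : z ∈ closedBall y R \ ball y (2 * (R / 3))
    · refine Or.inl ⟨hz.1, ?_⟩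
      have h2 := hz.2
      rw [mem_ball, dist_eq_norm, norm_sub_rev, not_lt] at h2
      exact h2
    · exact Or.inr (hoff z hz)
  -- kernel bounds on the shell
  have hΓ : ∀ z, 2 * (R / 3) ≤ ‖y - z‖ → |newtonKernel (y - z)| ≤ R⁻¹ := by
    intro z hz
    have hpos : 0 < ‖y - z‖ := lt_of_lt_of_le (by positivity) hz
    rw [abs_newtonKernel, inv_le_inv₀ (by positivity) hR]
    nlinarith [Real.pi_gt_three, norm_nonneg (y - z)]
  have hDΓ : ∀ z, 2 * (R / 3) ≤ ‖y - z‖ → ‖fderiv ℝ newtonKernel (y - z)‖ ≤ (R ^ 2)⁻¹ := by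
    intro z hz
    have hpos : 0 < ‖y - z‖ := lt_of_lt_of_le (by positivity) hz
    refine (norm_fderiv_newtonKernel_le _).trans ?_
    rw [inv_le_inv₀ (by positivity) (by positivity)]
    have h2 : (2 * (R / 3)) ^ 2 ≤ ‖y - z‖ ^ 2 := pow_le_pow_left₀ (by positivity) hz 2
    nlinarith [Real.pi_gt_three, sq_nonneg ‖y - z‖]
  -- the orthonormal frame and the first-order coefficients `a i = ∂_i χ`
  set b := stdOrthonormalBasis ℝ (EuclideanSpace ℝ (Fin 3)) with hb
  have hbn : ∀ i, ‖b i‖ = 1 := fun i => b.orthonormal.1 i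
  obtain ⟨a, ha⟩ : ∃ a : Fin (Module.finrank ℝ (EuclideanSpace ℝ (Fin 3))) → (EuclideanSpace ℝ (Fin 3)) → ℝ, a = fun i z => fderiv ℝ χ z (b i) :=
    ⟨_, rfl⟩
  -- smoothness bookkeeping
  have hv1 : ContDiff ℝ 1 v := hv.of_le (by norm_num)
  have hvc : Continuous v := hv.continuous
  have hvd : ∀ z, DifferentiableAt ℝ v z := fun z => (hv.differentiable (by norm_num)) z
  have hω1 : ContDiff ℝ 1 (curl v) := contDiff_curl (n := 1) (by exact hv)
  have hωc : Continuous (curl v) := hω1.continuous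
  have hDχ1 : ContDiff ℝ 1 (fderiv ℝ χ) := hχ2.fderiv_right (m := 1) (by norm_num)
  have hDχd : ∀ z, DifferentiableAt ℝ (fderiv ℝ χ) z := fun z => (hDχ1.differentiable one_ne_zero) z
  have ha1 : ∀ i, ContDiff ℝ 1 (a i) := fun i => by rw [ha]; exact hDχ1.clm_apply contDiff_const
  have hac : ∀ i, Continuous (a i) := fun i => (ha1 i).continuous
  have had : ∀ i z, DifferentiableAt ℝ (a i) z := fun i z => ((ha1 i).differentiable one_ne_zero) z
  have has : ∀ i, HasCompactSupport (a i) := fun i => by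
    rw [ha]; exact hχc.fderiv_apply (𝕜 := ℝ) (b i)
  have hDv : ∀ i, Continuous fun z => fderiv ℝ v z (b i) := fun i =>
    (hv.continuous_fderiv two_ne_zero).clm_apply continuous_const
  have haz : ∀ i z, a i z = fderiv ℝ χ z (b i) := fun i z => by rw [ha]
  -- `Φ_i = a_i • v` and its derivative along `b i`
  have hΦ1 : ∀ i, ContDiff ℝ 1 (fun z => a i z • v z) := fun i => (ha1 i).smul hv1
  have hΦs : ∀ i, HasCompactSupport (fun z => a i z • v z) := fun i => (has i).smul_right
  have hDΦ : ∀ i z, fderiv ℝ (fun z => a i z • v z) z (b i) =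
      a i z • fderiv ℝ v z (b i) + (fderiv ℝ (a i) z (b i)) • v z := by
    intro i z
    rw [fderiv_fun_smul (had i z) (hvd z)]
    simp [ContinuousLinearMap.smulRight_apply]
  have hDa : ∀ i z, fderiv ℝ (a i) z (b i) = iteratedFDeriv ℝ 2 χ z ![b i, b i] := by
    intro i z
    rw [iteratedFDeriv_two_apply, ha]
    simp only
    rw [fderiv_clm_apply (hDχd z) (differentiableAt_const _)]
    simp
  have hDa_le : ∀ i z, |fderiv ℝ (a i) z (b i)| ≤ ‖iteratedFDeriv ℝ 2 χ z‖ := fun i z => by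
    rw [hDa]; exact abs_iteratedFDeriv_two_apply_le χ z (b i) (b i) (hbn i) (hbn i)
  have ha_le : ∀ i z, |a i z| ≤ ‖fderiv ℝ χ z‖ := fun i z => by
    rw [haz, ← Real.norm_eq_abs]
    exact ((fderiv ℝ χ z).le_opNorm (b i)).trans (by rw [hbn, mul_one])
  -- the lower-order density `G` and the representation at the centre
  obtain ⟨G, hGdef⟩ : ∃ G : (EuclideanSpace ℝ (Fin 3)) → (EuclideanSpace ℝ (Fin 3)),
      G = fun z => (Δ (fun w => χ w • v w)) z + curl (fun w => χ w • curl v w) z := ⟨_, rfl⟩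
  have hU2 : ContDiff ℝ 2 (fun w => χ w • v w) := hχ2.smul hv
  have hUc : HasCompactSupport (fun w => χ w • v w) := hχc.smul_right
  have hΨ1 : ContDiff ℝ 1 (fun w => χ w • curl v w) := hχ1.smul hω1
  have hΨc : HasCompactSupport (fun w => χ w • curl v w) := hχc.smul_right
  have hGc : Continuous G := by
    rw [hGdef]
    exact (contDiff_laplacian (n := 0) (by exact hU2)).continuous.add (continuous_curl hΨ1)
  have hGs : HasCompactSupport G := by
    rw [hGdef]
    refine HasCompactSupport.add ?_ (hasCompactSupport_curl hΨc)
    exact HasCompactSupport.of_support_subset_isCompact hUc.isCompact fun z hz => by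
      by_contra h
      exact hz (laplacian_eq_zero_of_notMem_tsupport h)
  have hrep : v y - biotSavart (cutVorticity v y R) y = ∫ z, newtonKernel (y - z) • G z := by
    have h := smul_eq_biotSavart_add_integral_newtonKernel hv hχ2 hχc y
    rw [hχy, one_smul] at h
    have hcut : (fun w => χ w • curl v w) = cutVorticity v y R := by
      funext w; rw [hχdef]; rfl
    rw [← hcut, h, add_sub_cancel_left, hGdef]
  -- the first-order part `T = 2 Σ_i a_i • ∂_i v` of the density
  obtain ⟨T, hTdef⟩ : ∃ T : (EuclideanSpace ℝ (Fin 3)) → (EuclideanSpace ℝ (Fin 3)),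
      T = fun z => (2 : ℝ) • ∑ i, a i z • fderiv ℝ v z (b i) := ⟨_, rfl⟩
  have hTc : Continuous T := by
    rw [hTdef]
    exact (continuous_finsetSum Finset.univ (fun i _ => (hac i).smul (hDv i))).const_smul (2 : ℝ)
  have hTs : HasCompactSupport T := by
    rw [hTdef]
    refine HasCompactSupport.intro (isCompact_closedBall y R) fun z hz => ?_
    have h0 : fderiv ℝ χ z = 0 := (hoff z (fun h => hz h.1)).1
    simp [haz, h0]
  have hdens : ∀ z, G z =
      curlCLM ((fderiv ℝ χ z).smulRight (curl v z)) + T z + ((Δ χ) z) • v z := by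
    intro z
    rw [hGdef, hTdef]
    simp only [haz]
    exact laplacian_smul_add_curl_smul_curl_eq hv hχ2 (Or.inr (Eventually.of_forall hdiv))
  have hPdens : ∀ z, G z - T z =
      curlCLM ((fderiv ℝ χ z).smulRight (curl v z)) + ((Δ χ) z) • v z := by
    intro z; rw [hdens z]; abel
  have hPc : Continuous fun z => G z - T z := hGc.sub hTc
  have hPs : HasCompactSupport fun z => G z - T z := hGs.sub hTs
  -- splitting the Newtonian integral
  have hIP : Integrable fun z => newtonKernel (y - z) • (G z - T z) :=
    integrable_newtonKernel_smul hPc hPs y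
  have hIT : Integrable fun z => newtonKernel (y - z) • T z := integrable_newtonKernel_smul hTc hTs y
  have hsplit : ∫ z, newtonKernel (y - z) • G z =
      (∫ z, newtonKernel (y - z) • (G z - T z)) + ∫ z, newtonKernel (y - z) • T z := by
    rw [← integral_add hIP hIT]
    congr 1; funext z; rw [← smul_add, sub_add_cancel]
  have hIi : ∀ i, Integrable fun z => newtonKernel (y - z) • (a i z • fderiv ℝ v z (b i)) :=
    fun i => integrable_newtonKernel_smul ((hac i).smul (hDv i)) ((has i).smul_right) y
  have hTint : ∫ z, newtonKernel (y - z) • T z =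
      (2 : ℝ) • ∑ i, ∫ z, newtonKernel (y - z) • (a i z • fderiv ℝ v z (b i)) := by
    rw [← integral_finsetSum _ (fun i _ => hIi i), ← integral_smul]
    congr 1; funext z
    rw [hTdef]; simp only
    rw [smul_comm (newtonKernel (y - z)) (2 : ℝ), Finset.smul_sum]
  -- integration by parts, one index at a time
  have hIBP : ∀ i, ∫ z, newtonKernel (y - z) • (a i z • fderiv ℝ v z (b i)) =
      (∫ z, (fderiv ℝ newtonKernel (y - z) (b i)) • (a i z • v z)) -
        ∫ z, newtonKernel (y - z) • ((fderiv ℝ (a i) z (b i)) • v z) := by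
    intro i
    have h1 := integral_newtonKernel_smul_fderiv_eq (hΦ1 i) (hΦs i) y (b i)
    have hI2 : Integrable fun z => newtonKernel (y - z) • ((fderiv ℝ (a i) z (b i)) • v z) :=
      integrable_newtonKernel_smul
        ((((ha1 i).continuous_fderiv one_ne_zero).clm_apply continuous_const).smul hvc)
        (((has i).fderiv_apply (𝕜 := ℝ) (b i)).smul_right) y
    have hI1 : Integrable fun z => newtonKernel (y - z) • fderiv ℝ (fun z => a i z • v z) z (b i) :=
      integrable_newtonKernel_smul (((hΦ1 i).continuous_fderiv one_ne_zero).clm_apply continuous_const)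
        ((hΦs i).fderiv_apply (𝕜 := ℝ) (b i)) y
    rw [← h1, ← integral_sub hI1 hI2]
    congr 1; funext z; rw [hDΦ i z, smul_add, add_sub_cancel_right]
  -- the majorants
  obtain ⟨mV, hmVdef⟩ : ∃ mV : (EuclideanSpace ℝ (Fin 3)) → ℝ, mV = (closedBall y R).indicator fun z => ‖v z‖ := ⟨_, rfl⟩
  obtain ⟨mW, hmWdef⟩ : ∃ mW : (EuclideanSpace ℝ (Fin 3)) → ℝ, mW = (closedBall y R).indicator fun z => ‖curl v z‖ :=
    ⟨_, rfl⟩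
  have hmVi : Integrable mV := by
    rw [hmVdef, integrable_indicator_iff measurableSet_closedBall]
    exact hvc.norm.continuousOn.integrableOn_compact (isCompact_closedBall y R)
  have hmWi : Integrable mW := by
    rw [hmWdef, integrable_indicator_iff measurableSet_closedBall]
    exact hωc.norm.continuousOn.integrableOn_compact (isCompact_closedBall y R)
  have hmV0 : ∀ z, 0 ≤ mV z := fun z => by
    rw [hmVdef]; exact indicator_nonneg (fun _ _ => norm_nonneg _) _
  have hmW0 : ∀ z, 0 ≤ mW z := fun z => by
    rw [hmWdef]; exact indicator_nonneg (fun _ _ => norm_nonneg _) _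
  have hmVin : ∀ z ∈ closedBall y R, mV z = ‖v z‖ := fun z hz => by
    rw [hmVdef, indicator_of_mem hz]
  have hmWin : ∀ z ∈ closedBall y R, mW z = ‖curl v z‖ := fun z hz => by
    rw [hmWdef, indicator_of_mem hz]
  have hae : closedBall y R =ᵐ[volume] ball y R :=
    (ae_eq_of_subset_of_measure_ge ball_subset_closedBall
      (Measure.addHaar_closedBall_eq_addHaar_ball volume y R).le
      measurableSet_ball.nullMeasurableSet measure_closedBall_lt_top.ne).symm
  have hmVint : ∫ z, mV z = ∫ z in ball y R, ‖v z‖ := by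
    rw [hmVdef, integral_indicator measurableSet_closedBall, setIntegral_congr_set hae]
  have hmWint : ∫ z, mW z = ∫ z in ball y R, ‖curl v z‖ := by
    rw [hmWdef, integral_indicator measurableSet_closedBall, setIntegral_congr_set hae]
  -- pointwise bounds
  have hsr0 : ∀ w : (EuclideanSpace ℝ (Fin 3)), (0 : (EuclideanSpace ℝ (Fin 3)) →L[ℝ] ℝ).smulRight w = 0 := fun w => by
    ext u; simp
  have hP1 : ∀ z, ‖newtonKernel (y - z) • (G z - T z)‖ ≤
      (3 * ‖curlCLM‖ * C₀ * (R ^ 2)⁻¹) * mW z + (27 * C₂ * (R ^ 3)⁻¹) * mV z := by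
    intro z
    rcases hcase z with ⟨hz, hdist⟩ | ⟨h0, h00⟩
    · rw [hmVin z hz, hmWin z hz, norm_smul, Real.norm_eq_abs, hPdens z]
      have hG1 : ‖curlCLM ((fderiv ℝ χ z).smulRight (curl v z))‖ ≤
          ‖curlCLM‖ * (3 * C₀ * R⁻¹) * ‖curl v z‖ := by
        have e1 : ‖curlCLM ((fderiv ℝ χ z).smulRight (curl v z))‖ ≤
            ‖curlCLM‖ * ‖(fderiv ℝ χ z).smulRight (curl v z)‖ := ContinuousLinearMap.le_opNorm _ _
        rw [ContinuousLinearMap.norm_smulRight_apply] at e1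
        have e2 : ‖curlCLM‖ * (‖fderiv ℝ χ z‖ * ‖curl v z‖) ≤ ‖curlCLM‖ * ((3 * C₀ * R⁻¹) * ‖curl v z‖) :=
          mul_le_mul_of_nonneg_left (mul_le_mul_of_nonneg_right (hDχ z) (norm_nonneg _)) hκ0
        calc _ ≤ _ := e1
          _ ≤ _ := e2
          _ = ‖curlCLM‖ * (3 * C₀ * R⁻¹) * ‖curl v z‖ := by ring
      have hG3 : ‖((Δ χ) z) • v z‖ ≤ 3 * (9 * C₂ * (R ^ 2)⁻¹) * ‖v z‖ := by
        rw [norm_smul, Real.norm_eq_abs]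
        have e3 : |(Δ χ) z| ≤ 3 * (9 * C₂ * (R ^ 2)⁻¹) :=
          (abs_laplacian_le_three_mul_norm_iteratedFDeriv χ z).trans
            (mul_le_mul_of_nonneg_left (hD2χ z) (by norm_num))
        exact mul_le_mul_of_nonneg_right e3 (norm_nonneg _)
      have hsum := (norm_add_le _ _).trans (add_le_add hG1 hG3)
      have hΓz := hΓ z hdist
      have step : |newtonKernel (y - z)| *
          ‖curlCLM ((fderiv ℝ χ z).smulRight (curl v z)) + ((Δ χ) z) • v z‖ ≤
          R⁻¹ * (‖curlCLM‖ * (3 * C₀ * R⁻¹) * ‖curl v z‖ + 3 * (9 * C₂ * (R ^ 2)⁻¹) * ‖v z‖) :=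
        mul_le_mul hΓz hsum (norm_nonneg _) (inv_nonneg.2 hR.le)
      have e4 : R⁻¹ * (‖curlCLM‖ * (3 * C₀ * R⁻¹) * ‖curl v z‖ + 3 * (9 * C₂ * (R ^ 2)⁻¹) * ‖v z‖) =
          (3 * ‖curlCLM‖ * C₀ * (R ^ 2)⁻¹) * ‖curl v z‖ + (27 * C₂ * (R ^ 3)⁻¹) * ‖v z‖ := by
        have e5 : (R ^ 2)⁻¹ = R⁻¹ * R⁻¹ := by rw [sq, mul_inv]
        have e6 : (R ^ 3)⁻¹ = R⁻¹ * (R⁻¹ * R⁻¹) := by rw [pow_succ, pow_two, mul_inv, mul_inv]; ring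
        rw [e5, e6]; ring
      rw [← e4]; exact step
    · have hΔ : (Δ χ) z = 0 := by
        have h3 := abs_laplacian_le_three_mul_norm_iteratedFDeriv χ z
        rw [h00, norm_zero, mul_zero] at h3
        exact abs_eq_zero.1 (le_antisymm h3 (abs_nonneg _))
      have hP0 : G z - T z = 0 := by
        rw [hPdens z, h0, hΔ, hsr0, map_zero, zero_smul, add_zero]
      rw [hP0, smul_zero, norm_zero]
      exact add_nonneg (mul_nonneg (by positivity) (hmW0 z)) (mul_nonneg (by positivity) (hmV0 z))
  have hP2 : ∀ i z, ‖(fderiv ℝ newtonKernel (y - z) (b i)) • (a i z • v z)‖ ≤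
      (3 * C₀ * (R ^ 3)⁻¹) * mV z := by
    intro i z
    rcases hcase z with ⟨hz, hdist⟩ | ⟨h0, h00⟩
    · rw [hmVin z hz, norm_smul, norm_smul, Real.norm_eq_abs, Real.norm_eq_abs]
      have h1 : |fderiv ℝ newtonKernel (y - z) (b i)| ≤ (R ^ 2)⁻¹ := by
        rw [← Real.norm_eq_abs]
        exact ((fderiv ℝ newtonKernel (y - z)).le_opNorm (b i)).trans
          (by rw [hbn, mul_one]; exact hDΓ z hdist)
      have h2 : |a i z| ≤ 3 * C₀ * R⁻¹ := (ha_le i z).trans (hDχ z)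
      calc |fderiv ℝ newtonKernel (y - z) (b i)| * (|a i z| * ‖v z‖)
          ≤ (R ^ 2)⁻¹ * ((3 * C₀ * R⁻¹) * ‖v z‖) := by gcongr
        _ = (3 * C₀ * (R ^ 3)⁻¹) * ‖v z‖ := by ring
    · have : a i z = 0 := by rw [haz, h0]; simp
      rw [this, zero_smul, smul_zero, norm_zero]
      have := hmV0 z; positivity
  have hP3 : ∀ i z, ‖newtonKernel (y - z) • ((fderiv ℝ (a i) z (b i)) • v z)‖ ≤
      (9 * C₂ * (R ^ 3)⁻¹) * mV z := by
    intro i z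
    rcases hcase z with ⟨hz, hdist⟩ | ⟨h0, h00⟩
    · rw [hmVin z hz, norm_smul, norm_smul, Real.norm_eq_abs, Real.norm_eq_abs]
      have h1 := hΓ z hdist
      have h2 : |fderiv ℝ (a i) z (b i)| ≤ 9 * C₂ * (R ^ 2)⁻¹ := (hDa_le i z).trans (hD2χ z)
      calc |newtonKernel (y - z)| * (|fderiv ℝ (a i) z (b i)| * ‖v z‖)
          ≤ R⁻¹ * ((9 * C₂ * (R ^ 2)⁻¹) * ‖v z‖) := by gcongr
        _ = (9 * C₂ * (R ^ 3)⁻¹) * ‖v z‖ := by ring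
    · have : fderiv ℝ (a i) z (b i) = 0 := by rw [hDa, h00]; simp
      rw [this, zero_smul, smul_zero, norm_zero]
      have := hmV0 z; positivity
  -- integrate the bounds
  have hPbound : ‖∫ z, newtonKernel (y - z) • (G z - T z)‖ ≤
      (3 * ‖curlCLM‖ * C₀ * (R ^ 2)⁻¹) * (∫ z in ball y R, ‖curl v z‖) +
        (27 * C₂ * (R ^ 3)⁻¹) * (∫ z in ball y R, ‖v z‖) := by
    have hgi : Integrable fun z => (3 * ‖curlCLM‖ * C₀ * (R ^ 2)⁻¹) * mW z + (27 * C₂ * (R ^ 3)⁻¹) * mV z :=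
      (hmWi.const_mul _).add (hmVi.const_mul _)
    have h := norm_integral_le_of_norm_le hgi (Eventually.of_forall hP1)
    rw [integral_add (hmWi.const_mul _) (hmVi.const_mul _), integral_const_mul, integral_const_mul,
      hmVint, hmWint] at h
    exact h
  have hTi_bound : ∀ i, ‖∫ z, newtonKernel (y - z) • (a i z • fderiv ℝ v z (b i))‖ ≤
      (3 * C₀ + 9 * C₂) * (R ^ 3)⁻¹ * ∫ z in ball y R, ‖v z‖ := by
    intro i
    rw [hIBP i]
    refine (norm_sub_le _ _).trans ?_
    have h2 := norm_integral_le_of_norm_le (hmVi.const_mul (3 * C₀ * (R ^ 3)⁻¹))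
      (Eventually.of_forall (hP2 i))
    have h3 := norm_integral_le_of_norm_le (hmVi.const_mul (9 * C₂ * (R ^ 3)⁻¹))
      (Eventually.of_forall (hP3 i))
    rw [integral_const_mul, hmVint] at h2 h3
    calc _ ≤ _ := add_le_add h2 h3
      _ = (3 * C₀ + 9 * C₂) * (R ^ 3)⁻¹ * ∫ z in ball y R, ‖v z‖ := by ring
  have hcard : (Finset.univ : Finset (Fin (Module.finrank ℝ (EuclideanSpace ℝ (Fin 3))))).card = 3 := by
    rw [Finset.card_univ, Fintype.card_fin, finrank_euclideanSpace, Fintype.card_fin]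
  have hTbound : ‖∫ z, newtonKernel (y - z) • T z‖ ≤
      (18 * C₀ + 54 * C₂) * (R ^ 3)⁻¹ * ∫ z in ball y R, ‖v z‖ := by
    rw [hTint, norm_smul, Real.norm_eq_abs, abs_two]
    calc 2 * ‖∑ i, ∫ z, newtonKernel (y - z) • (a i z • fderiv ℝ v z (b i))‖
        ≤ 2 * ∑ i, ‖∫ z, newtonKernel (y - z) • (a i z • fderiv ℝ v z (b i))‖ := by
          gcongr; exact norm_sum_le _ _
      _ ≤ 2 * ∑ _i : Fin (Module.finrank ℝ (EuclideanSpace ℝ (Fin 3))),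
            (3 * C₀ + 9 * C₂) * (R ^ 3)⁻¹ * ∫ z in ball y R, ‖v z‖ := by
          gcongr with i _
          exact hTi_bound i
      _ = (18 * C₀ + 54 * C₂) * (R ^ 3)⁻¹ * ∫ z in ball y R, ‖v z‖ := by
          rw [Finset.sum_const, hcard, nsmul_eq_mul]; push_cast; ring
  -- assemble
  have IV0 : 0 ≤ ∫ z in ball y R, ‖v z‖ := setIntegral_nonneg measurableSet_ball fun _ _ => norm_nonneg _
  have IW0 : 0 ≤ ∫ z in ball y R, ‖curl v z‖ :=
    setIntegral_nonneg measurableSet_ball fun _ _ => norm_nonneg _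
  have hX : 0 ≤ (R ^ 3)⁻¹ * ∫ z in ball y R, ‖v z‖ := mul_nonneg (by positivity) IV0
  have hY : 0 ≤ (R ^ 2)⁻¹ * ∫ z in ball y R, ‖curl v z‖ := mul_nonneg (by positivity) IW0
  rw [hrep, hsplit]
  calc ‖(∫ z, newtonKernel (y - z) • (G z - T z)) + ∫ z, newtonKernel (y - z) • T z‖
      ≤ ‖∫ z, newtonKernel (y - z) • (G z - T z)‖ + ‖∫ z, newtonKernel (y - z) • T z‖ :=
        norm_add_le _ _
    _ ≤ _ := add_le_add hPbound hTbound
    _ ≤ (1 + 81 * C₂ + 18 * C₀ + 3 * ‖curlCLM‖ * C₀) *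
          ((R ^ 3)⁻¹ * (∫ x in ball y R, ‖v x‖) + (R ^ 2)⁻¹ * (∫ x in ball y R, ‖curl v x‖)) := by
        nlinarith [mul_nonneg (mul_nonneg hκ0 hC₀0) hX, mul_nonneg hC₂0 hY, mul_nonneg hC₀0 hY,
          mul_nonneg hC₂0 hX, mul_nonneg hC₀0 hX, mul_nonneg (mul_nonneg hκ0 hC₀0) hY, hX, hY]


/-- H2♭ under its registered stub name. -/
theorem stub_shellKernelBound : ShellKernelBound := shellKernelBound_holds

end Summit.NavierStokesRegularity.NavierStokesRegularity.Cruxes.TypeIQuantSubcubicExp.HelmholtzCentre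

end
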